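import Summits.SmoothPoincare4.SmoothPoincare4.Theorems.EntropyRungSubcylindricalExistenceTheoremA
import Summits.SmoothPoincare4.SmoothPoincare4.Theorems.SubcylindricalExistence.Negative.Logic
import Literature.Geometry.Riemannian.ShrinkingRoundSphereFour
import Literature.Geometry.Lorentzian.CurvatureNaturality
import Literature.Geometry.Lorentzian.RiemannianVolumeIsometry
import Literature.Geometry.Lorentzian.IsometryProofs
import Literature.Geometry.Lorentzian.LeviCivitaProofs
import HarnessLib

/-!
# Transport of the round witness along diffeomorphisms: `SPC4 → ENT`, and `ENT ↔ SPC4` given the rung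
(line `curvature-dimension-entropy-floor`, crux `EntropyRung.SubcylindricalExistence`,
item stmt-SmoothPoincare4-10871; the diffeomorphism-invariant half of its one open stub
`stub_ricciFatMetric`)

The only open registered stub of the line is Statement D (`RicciFatMetric`): every closed smooth
`M ≃ₕ S⁴` carries a Riemannian metric with Levi-Civita connection, `Ric ≥ 3g` and
`Vol > (√π e^{1/2}/3)(8π²/3)`. It is SPC4-hard; what IS provable is its value on every `M` already
KNOWN to be diffeomorphic to `S⁴`, by transporting the round metric:

* `exists_roundMetric_transport`, `ricciFatMetric_of_diffeomorph` — for ANY `C^∞` atlas on `M` and any diffeomorphism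
  `Φ : M ≃ₘ⟮𝓡 4, 𝓡 4⟯ S⁴`, the pullback `g = Φ^* g_{S⁴}` (`PseudoRiemannianMetric.comap`, smooth by
  `contMDiff_pullbackBilin_holds`) is Riemannian, has its Levi-Civita connection (`hasLeviCivita`),
  satisfies `Ric_g = 3g` (naturality `ricci_comap_apply` + `ricci_roundMetric_four`) and
  `Vol(M, g) = Vol(S⁴) = 8π²/3` (`IsIsometry.riemannianMeasure_image_eq` +
  `riemannianMeasure_roundMetric_sphere_four_univ`); hence Statement D's clause for `M`
  (`ricciFatClause_of_diffeomorph`, threshold `√(πe) < 2.94 < 3`).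
* `subcylindricalClause_of_diffeomorph` — consequently ENT's conclusion for every such `M`
  (Theorem A `entropyVolumeComparison` at `Vol = 8π²/3`: `δ = ν(S⁴) − ν_cyl ∈ (0.026, 0.0263)`).
* `ricciFatMetric_of_spc4`, `subcylindricalExistence_of_spc4` — `SmoothPoincare4 → RicciFatMetric` and
  `SmoothPoincare4 → SubcylindricalExistence`, UNCONDITIONALLY (the hypothesis `hW` of
  `Negative.subcylindricalExistence_of_spc4_of_transport` is discharged).
* `subcylindricalExistence_iff_spc4` — given the rung `SubcylindricalRecognition`
  (stmt-SmoothPoincare4-10869), `SubcylindricalExistence ↔ SmoothPoincare4`: the crux is EXACTLY the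
  summit modulo the rung, as a tree theorem (previously modulo `hW`).
(The same transport proves route RicciFat's support statement `Spc4ImpliesRicciFatSphere`,
stmt-SmoothPoincare4-5193, verbatim — filed separately as `RicciFatSpc4ImpliesRicciFatSphere.lean`.)

Everything is proved (no `sorry`, no definition, no named fact).

References: [ONeill1983] Ch. 3, Prop. 3.59 (curvature is natural under isometries);
[Federer1969] §2.10.11 (Hausdorff measure under isometries); [Topping2006] §1.2.1 (`Ric(S⁴) = 3g`);
[CaoHamiltonIlmanen2004] Thm 3.4 (`ν(S⁴) = log 6 − 2`).
-/

noncomputable section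

-- the registered namespace `Summit.SmoothPoincare4.SmoothPoincare4.Theorems` repeats a component
set_option linter.dupNamespace false

open scoped Manifold ContDiff Topology ENNReal NNReal ContinuousMap
open Set MeasureTheory
open Literature.Geometry.Lorentzian Literature.Geometry.Riemannian

namespace Summit.SmoothPoincare4.SmoothPoincare4.Theorems

/-! ## The round metric pulled back along a diffeomorphism -/

section Transport

variable {M : Type} [TopologicalSpace M] [ChartedSpace (EuclideanSpace ℝ (Fin 4)) M]
  [IsManifold (𝓡 4) ∞ M]

omit [IsManifold (𝓡 4) ∞ M] in
/-- The differentials of a `C^∞` diffeomorphism onto `S⁴` are injective. [folklore] -/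
theorem mfderiv_injective_of_diffeomorph_sphereFour (Φ : M ≃ₘ⟮𝓡 4, 𝓡 4⟯ SphereFour) (x : M) :
    Function.Injective (mfderiv (𝓡 4) (𝓡 4) Φ x) :=
  (Φ.mfderivToContinuousLinearEquiv (by simp) x).injective

/-- **The round metric transported along a diffeomorphism.** For any `C^∞` atlas on `M` and any
`Φ : M ≃ₘ S⁴`, the pullback `g = Φ^* g_{S⁴}` (`PseudoRiemannianMetric.comap`; smoothness of the
pullback by `contMDiff_pullbackBilin_holds`) is a Riemannian metric on `M` with its Levi-Civita
connection (`hasLeviCivita`), `Ric_g = 3g` (naturality of the Ricci tensor `ricci_comap_apply` and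
`Ric(g_{S⁴}) = 3 g_{S⁴}`, `ricci_roundMetric_four`) and `Vol(M, g) = Vol(S⁴) = 8π²/3` (isometric
diffeomorphisms preserve the Riemannian measure, `IsIsometry.riemannianMeasure_image_eq`, and
`riemannianMeasure_roundMetric_sphere_four_univ`). O'Neill 1983, Ch. 3, p. 58, pp. 90–91 and
Prop. 3.59; Federer 1969, §2.10.11. [cite: ONeill1983, Ch. 3, Prop. 3.59] -/
theorem exists_roundMetric_transport [T2Space M] [T3Space M] [MeasurableSpace M] [BorelSpace M]
    (Φ : M ≃ₘ⟮𝓡 4, 𝓡 4⟯ SphereFour) :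
    ∃ g : PseudoRiemannianMetric (𝓡 4) ∞ (EuclideanSpace ℝ (Fin 4)) (TangentSpace (𝓡 4) : M → Type _),
    ∃ _ : g.HasLeviCivita, ∃ hg : g.IsRiemannian,
      (∀ (x : M) (v w : TangentSpace (𝓡 4) x), g.ricci x v w = 3 * g.val x v w) ∧
      riemannianMeasure (g.toContMDiffRiemannianMetric hg) Set.univ = ENNReal.ofReal (8 * Real.pi ^ 2 / 3) := by
  -- the pullback metric `Φ^* g_{S⁴}`
  set g : PseudoRiemannianMetric (𝓡 4) ∞ (EuclideanSpace ℝ (Fin 4)) (TangentSpace (𝓡 4) : M → Type _) :=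
    (roundMetric (n := 4) EuclideanFive).comap PseudoRiemannianMetric.contMDiff_pullbackBilin_holds Φ
      Φ.contMDiff (mfderiv_injective_of_diffeomorph_sphereFour Φ) rfl with hgdef
  -- `Φ : (M, g) → (S⁴, g_{S⁴})` is an isometry by construction
  have hiso : PseudoRiemannianMetric.IsIsometry g (roundMetric (n := 4) EuclideanFive) Φ := fun _ ↦ rfl
  have hg : g.IsRiemannian := hiso.isRiemannian (by simp) isRiemannian_roundMetric
  haveI : g.HasLeviCivita := g.hasLeviCivita
  refine ⟨g, ‹_›, hg, fun x v w ↦ ?_, ?_⟩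
  · -- naturality of the Ricci tensor under the local diffeomorphism `Φ`
    have h := PseudoRiemannianMetric.ricci_comap_apply (roundMetric (n := 4) EuclideanFive)
      PseudoRiemannianMetric.contMDiff_pullbackBilin_holds Φ.contMDiff
      (mfderiv_injective_of_diffeomorph_sphereFour Φ) rfl x v w
    rw [h, ricci_roundMetric_four]
    rfl
  · -- isometric diffeomorphisms preserve the Riemannian measure; `Φ '' univ = univ`
    have h := hiso.riemannianMeasure_image_eq (by simp) hg isRiemannian_roundMetric Set.univ
    have hr : Set.range (⇑Φ) = Set.univ :=
      Set.range_eq_univ.2 fun y ↦ ⟨Φ.symm y, Φ.apply_symm_apply y⟩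
    rw [Set.image_univ, hr] at h
    rw [← h]
    exact riemannianMeasure_roundMetric_sphere_four_univ EuclideanFive

/-- **Statement D's clause on every `M` diffeomorphic to `S⁴`** (the diffeomorphism-invariant half
of the open stub `stub_ricciFatMetric`): for any `C^∞` atlas on `M` and any `Φ : M ≃ₘ S⁴` there is a
Riemannian `g` on `M` with Levi-Civita connection, `Ric ≥ 3g` and `Vol(M,g) = 8π²/3` (namely
`Φ^* g_{S⁴}`, `exists_roundMetric_transport`). [folklore] -/
theorem ricciFatMetric_of_diffeomorph [T2Space M] [T3Space M] [MeasurableSpace M] [BorelSpace M]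
    (Φ : M ≃ₘ⟮𝓡 4, 𝓡 4⟯ SphereFour) :
    ∃ g : PseudoRiemannianMetric (𝓡 4) ∞ (EuclideanSpace ℝ (Fin 4)) (TangentSpace (𝓡 4) : M → Type _),
    ∃ _ : g.HasLeviCivita, ∃ hg : g.IsRiemannian,
      (∀ (x : M) (v : TangentSpace (𝓡 4) x), 3 * g.val x v v ≤ g.ricci x v v) ∧
      (riemannianMeasure (g.toContMDiffRiemannianMetric hg) Set.univ).toReal = 8 * Real.pi ^ 2 / 3 := by
  obtain ⟨g, hLC, hg, hRic, hVol⟩ := exists_roundMetric_transport Φ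
  refine ⟨g, hLC, hg, fun x v ↦ (hRic x v v).symm.le, ?_⟩
  rw [hVol, ENNReal.toReal_ofReal (by positivity)]

/-- The fixed threshold of Statement D is below the round volume:
`(√π e^{1/2}/3)(8π²/3) < 8π²/3` (`√(πe) < 2.94 < 3`). [folklore] -/
theorem threshold_lt_roundVolume :
    Real.sqrt Real.pi * Real.exp (1 / 2 : ℝ) / 3 * (8 * Real.pi ^ 2 / 3) < 8 * Real.pi ^ 2 / 3 := by
  have hV : 0 < 8 * Real.pi ^ 2 / 3 := by positivity
  calc Real.sqrt Real.pi * Real.exp (1 / 2 : ℝ) / 3 * (8 * Real.pi ^ 2 / 3)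
      < (1 - 1 / 50) * (8 * Real.pi ^ 2 / 3) := threshold_lt_ricciFat_fiftieth
    _ ≤ 8 * Real.pi ^ 2 / 3 := by nlinarith

/-- **Statement D (`RicciFatMetric`) holds on every `M` diffeomorphic to `S⁴`**, in the exact shape
of the registered stub's conclusion (`Vol > (√π e^{1/2}/3)(8π²/3)`). [folklore] -/
theorem ricciFatClause_of_diffeomorph [T2Space M] [T3Space M] [MeasurableSpace M] [BorelSpace M]
    (Φ : M ≃ₘ⟮𝓡 4, 𝓡 4⟯ SphereFour) :
    ∃ g : PseudoRiemannianMetric (𝓡 4) ∞ (EuclideanSpace ℝ (Fin 4)) (TangentSpace (𝓡 4) : M → Type _),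
    ∃ _ : g.HasLeviCivita, ∃ hg : g.IsRiemannian,
      (∀ (x : M) (v : TangentSpace (𝓡 4) x), 3 * g.val x v v ≤ g.ricci x v v) ∧
      Real.sqrt Real.pi * Real.exp (1 / 2 : ℝ) / 3 * (8 * Real.pi ^ 2 / 3) <
        (riemannianMeasure (g.toContMDiffRiemannianMetric hg) Set.univ).toReal := by
  obtain ⟨g, hLC, hg, hRic, hVol⟩ := ricciFatMetric_of_diffeomorph Φ
  exact ⟨g, hLC, hg, hRic, hVol ▸ threshold_lt_roundVolume⟩

/-- **ENT's conclusion on every `M` diffeomorphic to `S⁴`** (any `C^∞` atlas): the transported round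
metric has `R = 12 > 0` and, by Theorem A at `Vol = 8π²/3` (`roundBound`), `μ(g,τ) ≥ log 6 − 2 =
ν_cyl + δ` for every `τ > 0` with `δ := ν(S⁴) − ν_cyl > 0` (`Negative.nuCyl_lt_nuRound`;
`0.026 < δ < 0.0263`). Connectedness of `M` (load-bearing for Theorem A) comes through `Φ` from `S⁴`.
[cite: CaoHamiltonIlmanen2004, Thm 3.4] -/
theorem subcylindricalClause_of_diffeomorph [T2Space M] [SecondCountableTopology M] [CompactSpace M]
    [T3Space M] [MeasurableSpace M] [BorelSpace M] (Φ : M ≃ₘ⟮𝓡 4, 𝓡 4⟯ SphereFour) :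
    ∃ g : PseudoRiemannianMetric (𝓡 4) ∞ (EuclideanSpace ℝ (Fin 4)) (TangentSpace (𝓡 4) : M → Type _),
    ∃ _ : g.HasLeviCivita, ∃ hg : g.IsRiemannian, (∀ x : M, 0 < g.scalarCurvature x) ∧
      ∃ δ : ℝ, 0 < δ ∧ ∀ τ : ℝ, 0 < τ → ∀ f : M → ℝ, ContMDiff (𝓡 4) 𝓘(ℝ, ℝ) ∞ f →
        ∫ x, (4 * Real.pi * τ) ^ (-(4 : ℝ) / 2) * Real.exp (-f x)
          ∂(riemannianMeasure (g.toContMDiffRiemannianMetric hg)) = 1 →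
        Real.log 2 + Real.log Real.pi / 2 - 3 / 2 + δ ≤
          ∫ x, (τ * (g.scalarCurvature x + g.gradSq f x) + f x - 4) *
            ((4 * Real.pi * τ) ^ (-(4 : ℝ) / 2) * Real.exp (-f x))
            ∂(riemannianMeasure (g.toContMDiffRiemannianMetric hg)) := by
  -- `M` is connected: it is the continuous image of the connected `S⁴` under `Φ.symm`
  haveI : ConnectedSpace M := Φ.symm.surjective.connectedSpace Φ.symm.continuous
  obtain ⟨g, hLC, hg, hRic, hVol⟩ := ricciFatMetric_of_diffeomorph Φ
  refine ⟨g, hLC, hg, fun x ↦ ?_, (Real.log 6 - 2) - (Real.log 2 + Real.log Real.pi / 2 - 3 / 2),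
    sub_pos.2 Summit.SmoothPoincare4.Cruxes.SubcylindricalExistence.Negative.nuCyl_lt_nuRound,
    fun τ hτ f hf hnorm ↦ ?_⟩
  · have h12 : 4 * (3 : ℝ) ≤ g.scalarCurvature x :=
      EntropyVolume.scalarCurvature_ge_four_mul_of_ricci_ge g hg (c := 3) (hRic x)
    linarith
  · have h := roundBound M g hg hRic hVol hτ hf hnorm
    linarith

end Transport

/-! ## `SPC4 → ENT`, and `ENT ↔ SPC4` given the rung -/

/-- **`SmoothPoincare4 → RicciFatMetric`**: if every smooth homotopy 4-sphere is diffeomorphic to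
`S⁴`, Statement D of the line holds (transport the round metric along the diffeomorphism).
[folklore] -/
theorem ricciFatMetric_of_spc4 :
    _root_.SmoothPoincare4 →
    ∀ (M : Type) [TopologicalSpace M] [T2Space M] [SecondCountableTopology M]
      [ChartedSpace (EuclideanSpace ℝ (Fin 4)) M] [IsManifold (𝓡 4) ∞ M] [CompactSpace M] [T3Space M]
      [MeasurableSpace M] [BorelSpace M],
      M ≃ₕ Metric.sphere (0 : EuclideanSpace ℝ (Fin 5)) 1 →
      ∃ g : PseudoRiemannianMetric (𝓡 4) ∞ (EuclideanSpace ℝ (Fin 4)) (TangentSpace (𝓡 4) : M → Type _),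
      ∃ _ : g.HasLeviCivita, ∃ hg : g.IsRiemannian,
        (∀ (x : M) (v : TangentSpace (𝓡 4) x), 3 * g.val x v v ≤ g.ricci x v v) ∧
        Real.sqrt Real.pi * Real.exp (1 / 2 : ℝ) / 3 * (8 * Real.pi ^ 2 / 3) <
          (riemannianMeasure (g.toContMDiffRiemannianMetric hg) Set.univ).toReal := by
  intro h M _ _ _ _ _ _ _ _ _ e
  obtain ⟨Φ⟩ := h M ‹ChartedSpace (EuclideanSpace ℝ (Fin 4)) M› ‹IsManifold (𝓡 4) ∞ M› e
  exact ricciFatClause_of_diffeomorph Φ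

/-- **`SmoothPoincare4 → SubcylindricalExistence`** (the converse costume check of the crux, now
unconditional): SPC4 gives Statement D by transport (`ricciFatMetric_of_spc4`), and D gives ENT by the
line's landed composition (`subcylindricalExistence_of_ricciFatMetric`: Theorem A + threshold
identity). This discharges the hypothesis `hW` of `Negative.subcylindricalExistence_of_spc4_of_transport`.
[folklore] -/
theorem subcylindricalExistence_of_spc4 (h : _root_.SmoothPoincare4) :
    _root_.Summit.SmoothPoincare4.SmoothPoincare4.Theses.EntropyRung.SubcylindricalExistence :=
  subcylindricalExistence_of_ricciFatMetric (ricciFatMetric_of_spc4 h)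

/-- **ENT ⇔ SPC4 given the rung**, unconditionally: with `SubcylindricalRecognition`
(stmt-SmoothPoincare4-10869), the crux `SubcylindricalExistence` (stmt-SmoothPoincare4-10871) is
EQUIVALENT to the smooth 4-dimensional Poincaré conjecture (`⇒`: the route's deciding theorem
`closes`; `⇐`: `subcylindricalExistence_of_spc4`). So the crux is false iff an exotic `S⁴` exists, and
a proof of it is a proof of SPC4 modulo the rung — its one open stub `stub_ricciFatMetric` carries
exactly that. [folklore] -/
theorem subcylindricalExistence_iff_spc4
    (hRung : _root_.Summit.SmoothPoincare4.SmoothPoincare4.Theses.EntropyRung.SubcylindricalRecognition) :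
    _root_.Summit.SmoothPoincare4.SmoothPoincare4.Theses.EntropyRung.SubcylindricalExistence ↔
      _root_.SmoothPoincare4 :=
  ⟨fun hEnt ↦ _root_.Summit.SmoothPoincare4.SmoothPoincare4.Theses.EntropyRung.closes hRung hEnt,
    subcylindricalExistence_of_spc4⟩

/-- **`RicciFatMetric ⇔ SPC4 given the rung`**: the open stub D of the line is itself equivalent to
SPC4 modulo `SubcylindricalRecognition` (`⇒`: `spc4_of_subcylindricalRecognition_of_ricciFatMetric`;
`⇐`: `ricciFatMetric_of_spc4`). [folklore] -/
theorem ricciFatMetric_iff_spc4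
    (hRung : _root_.Summit.SmoothPoincare4.SmoothPoincare4.Theses.EntropyRung.SubcylindricalRecognition) :
    (∀ (M : Type) [TopologicalSpace M] [T2Space M] [SecondCountableTopology M]
      [ChartedSpace (EuclideanSpace ℝ (Fin 4)) M] [IsManifold (𝓡 4) ∞ M] [CompactSpace M] [T3Space M]
      [MeasurableSpace M] [BorelSpace M],
      M ≃ₕ Metric.sphere (0 : EuclideanSpace ℝ (Fin 5)) 1 →
      ∃ g : PseudoRiemannianMetric (𝓡 4) ∞ (EuclideanSpace ℝ (Fin 4)) (TangentSpace (𝓡 4) : M → Type _),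
      ∃ _ : g.HasLeviCivita, ∃ hg : g.IsRiemannian,
        (∀ (x : M) (v : TangentSpace (𝓡 4) x), 3 * g.val x v v ≤ g.ricci x v v) ∧
        Real.sqrt Real.pi * Real.exp (1 / 2 : ℝ) / 3 * (8 * Real.pi ^ 2 / 3) <
          (riemannianMeasure (g.toContMDiffRiemannianMetric hg) Set.univ).toReal) ↔
      _root_.SmoothPoincare4 :=
  ⟨spc4_of_subcylindricalRecognition_of_ricciFatMetric hRung, ricciFatMetric_of_spc4⟩

end Summit.SmoothPoincare4.SmoothPoincare4.Theorems

end
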